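import Summits.BirchSwinnertonDyer.BirchSwinnertonDyer.Theorems.PrintX11aLowerHalfOddPrimeDoors
import Summits.BirchSwinnertonDyer.BirchSwinnertonDyer.Theorems.PrintX11aLowerHalfOddPrimeDefs
import Summits.BirchSwinnertonDyer.BirchSwinnertonDyer.Theorems.PrintX11aLowerHalfFromFiveOfMuAn
import Summits.BirchSwinnertonDyer.BirchSwinnertonDyer.Theorems.PrintX11aUpperNonSurjThreeMuAnHardThreeOfMazur
import HarnessLib

/-!
# Crux `X11aLowerHalf` (item stmt-BirchSwinnertonDyer-19064), `p = 3` part — BY NAME: the registered stub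
# `stub_lowerThreeDeep` from «certificate ∧ `MemberRatEqAt W 3`» on the deep X11a pairs at `3`, the `p ≥ 5`
# discharge of `MemberRatEqAt` by Wan's Thm. 4, and the whole crux body from three per-pair statements
# (`--supports stmt-BirchSwinnertonDyer-19064` helper; seat bsd-line-er5-p2 = -w3 width seat of the 19064 line)

HONEST FRAMING. Theorems only; no definition, no named fact, no `sorry`; NO route file imported (citable from a
route's `closes`). The restatement, through the predicates `OddChain.RatEqAtMember` ∕ `OddChain.MemberRatEqAt`
(`PrintX11aLowerHalfOddPrimeDefs.lean`, p615198), of the class-level theorems of `PrintX11aLowerHalfOddPrimeDoors.lean`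
(p615570). Everything is CONDITIONAL on displayed named facts and displayed `∀`-hypotheses; `MemberRatEqAt W 3` on the
deep X11a locus is NOT in print (X. Wan's Thm. 4 is printed for `p ⩾ 5`); BSD is not proved for any curve or class
by this file. beyond-print theorem: no.

## What

* `memberRatEqAt_of_wan_of_five_le` — **at `p ≥ 5` (`p ∥ N`, `E[p]` irreducible) `MemberRatEqAt W p` FOLLOWS from
  Wan's fact (irred instance) and the Modularity Theorem** (member of weight `2 + (p − 1)`): the new per-pair input
  is a published theorem there; only at `p = 3` is it new.
* `lowerThreeDeep_of_forall_muAn_memberRatEqAt_of_facts` — **`stub_lowerThreeDeep` (LITERALLY its statement) ⟸ 20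
  named facts + Greenberg–Stevens + `∀` deep X11a pairs at `3`: `X11a.MuAnZeroAt W 3 ∧ MemberRatEqAt W 3`.**
* `lowerThreeDeep_of_muAnThree_of_forall_memberRatEqAt_of_facts` — the same with the certificate replaced by
  «`μ^an = 0` at multiplicative `3`» AS A STATEMENT (`∀ E`, `3 ∥ N`, `E[3]` irreducible ⟹ `X11a.MuAnZeroAt W 3`; the
  x11a line p2 announced this as a class-free theorem modulo Mazur's Manin constant, 2026-08-28) — then the `p = 3`
  input is `MemberRatEqAt W 3` ALONE.
* `x11aLowerHalf_body_of_muAnFive_muAnThree_memberRatEqAtThree_of_facts` — **the WHOLE crux body** (`∀` X11a pairs,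
  `Typed.MissingLowerBoundAt`; = `Theses.ErratumRoadFive.X11aLowerHalf` unfolded) **from the named facts + THREE
  statements**: `stub_muAnDeepFive`'s (certificate on deep X11a at `p ≥ 5`, verbatim), «`μ^an = 0` at multiplicative
  `3`», and «`MemberRatEqAt W 3` on deep X11a at `3`» — a turnkey for the lead's next reshape (his call).
* `lowerThreeDeep_of_mazur_of_forall_memberRatEqAt_of_facts` ∕
  `x11aLowerHalf_body_of_muAnFive_mazur_memberRatEqAtThree_of_facts` — the same with «`μ^an = 0` at multiplicative
  `3`» DISCHARGED by the x11a line p2's tree theorem `MultThreeMuAn.muAnZeroAt_three_of_mult_of_irr` (modulo Mazur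
  1978 Cor. 4.1, `mazur_not_dvd_maninConstant_of_odd`): **at `p = 3` the registered stub ⟸ 21 named published facts
  + ONE statement, `MemberRatEqAt W 3` on the deep X11a pairs** («Wan's Thm. 4 at `p = 3`», not in print).

References: [Wan2015] Thm. 4 (p. 4) = Thm. 103; [EmertonPollackWeston2006] Thm. 1, 3.1.1, 5.1.3, p. 5;
[Wuthrich2014] Lemma 20, Cor. 18–19; [Kato2004Asterisque] Thm. 12.4, §17.13; [GreenbergLNM1716] Conj. 1.11 (shape);
[Miller2011LMS] Def. 1.1; [Mazur1978] Cor. 4.1.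
-/

set_option autoImplicit false
set_option linter.dupNamespace false -- the directory name repeats the summit name (sibling precedent)

noncomputable section

open scoped Classical MatrixGroups ModularForm

open CongruenceSubgroup UpperHalfPlane WeierstrassCurve Literature.NumberTheory.EllipticCurves
  Literature.NumberTheory.EllipticCurves.ModularForms
  Literature.NumberTheory.EllipticCurves.Rank1Residual
  Literature.NumberTheory.EllipticCurves.Rank1Residual.Typed
  Literature.NumberTheory.EllipticCurves.Wuthrich2014
  Literature.NumberTheory.EllipticCurves.SteinWuthrich2013
  Literature.NumberTheory.EllipticCurves.Greenberg1999
  Literature.NumberTheory.EllipticCurves.Kato2004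
  Literature.NumberTheory.EllipticCurves.GreenbergVatsal2000
  Literature.NumberTheory.EllipticCurves.EmertonPollackWeston2006
  Literature.NumberTheory.GaloisRepresentations
  Summit.BirchSwinnertonDyer.Rank1Residual
  Summit.BirchSwinnertonDyer.Rank1Residual.X1.MuLambda
  Summit.BirchSwinnertonDyer.Rank1Residual.X11a
  Summit.BirchSwinnertonDyer.Rank1Residual.X11a.LambdaNorm
  Summit.BirchSwinnertonDyer.Rank1Residual.X11a.Chain

namespace Summit.BirchSwinnertonDyer.BirchSwinnertonDyer.Theorems.OddChain

/-! ### §5 `MemberRatEqAt` at `p ≥ 5` is a published theorem (Wan 2015 Thm. 4 + modularity) -/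

section FiveLe

variable (W : WeierstrassCurve ℚ) [W.IsElliptic] [W.IsGloballyMinimal] (p : ℕ) [Fact p.Prime]

/-- **At a multiplicative `p ≥ 5` with `E[p]` irreducible, `MemberRatEqAt W p` holds, granted Wan's Thm. 4 (irred
instance, `hT2`) and the Modularity Theorem (`hNf`)**: the member of weight `2 + (p − 1)` and some level `M ∣ N/p`
(`exists_memberOfLevel_of_exists_isNewformOf_odd`; `p − 1 ≥ 4` is even) carries the rational equality by
`ratEqAtMember_of_wan`. So the second per-pair input of the odd-prime chain is NEW only at `p = 3`.
[cite: Wan2015, Thm. 4 (pp. 4–5) = Thm. 103 (pp. 91–92)] [cite: EmertonPollackWeston2006, §2.1 and Ex. 5.3.1] -/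
theorem memberRatEqAt_of_wan_of_five_le (hNf : exists_isNewformOf)
    (hT2 : Wan2015.thm4_rational_weightK_member_of_bdd_ofLevel_irred) (hp : 5 ≤ p)
    (hmult : W.HasMultiplicativeReductionAtPrime p) (hirr : W.HasIrreducibleModPGaloisRep p) :
    MemberRatEqAt W p := by
  have hprime : p.Prime := Fact.out
  have hp2 : p ≠ 2 := by omega
  have hw3 : 3 ≤ p - 1 := by omega
  have hwe : Even (p - 1) := hprime.even_sub_one hp2
  obtain ⟨M, instM, hpM, g, ι, hmem⟩ :=
    exists_memberOfLevel_of_exists_isNewformOf_odd W p hNf hp2 hmult (p - 1) hw3 hwe dvd_rfl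
  exact ⟨M, instM, hpM, _, g, ι, hmem, ratEqAtMember_of_wan hT2 W p hp hmult hirr hpM g ι hmem⟩

end FiveLe

/-! ### §6 The registered `p = 3` stub and the whole crux body, BY NAME -/

section ClassLevel

/-- **`stub_lowerThreeDeep` (line birth r3 of crux `X11aLowerHalf`; LITERALLY its statement) from 20 named facts +
Greenberg–Stevens + ONE `∀`-hypothesis on the deep X11a pairs at `3`: the certificate `X11a.MuAnZeroAt W 3` and
`MemberRatEqAt W 3`** (a good-ordinary member of `H(E[3])` with the rational cyclotomic equality — not in print at
`3`). Restatement of `lowerThreeDeep_of_forall_muAn_member_ratEq_of_facts` (p615570) through the predicate (definitional).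
CONDITIONAL; closes nothing by itself. [cite: Wan2015, Thm. 4 (p. 4: "Suppose that p ⩾ 5")]
[cite: EmertonPollackWeston2006, Thm. 5.1.3] [cite: Wuthrich2014, Lemma 20 (p. 399)] [cite: Miller2011LMS, Def. 1.1] -/
theorem lowerThreeDeep_of_forall_muAn_memberRatEqAt_of_facts
    (hNf : exists_isNewformOf)
    (h311 : thm311_cotorsion_weightK_member_ofLevel_odd) (hT1a : thm1_muAlg_of_weightK_member_ofLevel_odd)
    (hT1b : thm513_transfer_from_weightK_member_of_bdd_ofLevel_odd)
    (h61 : DeligneSerre1974.thm61_exists_adicGaloisRep) (h326 : Hida2000_thm326_ordinary)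
    (hKato : kato_charIdeal_dvd_multiplicative_of_surjective)
    (h20 : lemma20_surjective_threeAdic_of_semistable)
    (h12 : Kato2004.thm12_4)
    (hns : Kato2004.exists_multDivisibilityInputs_nonsplit)
    (hsp : Kato2004.exists_multDivisibilityInputs_split)
    (h15 : thm15_isTorsion_multiplicative_rat)
    (h18 : Wuthrich2014.corollary18_padicLFunction_mem_iwasawaAlgebra_multiplicative)
    (hfine : Kato2004.exists_multDivisibilityInputs_fine)
    (hJs : thm61_splitMultiplicative) (hJn : thm61_nonsplitMultiplicative)
    (hGZK : rank_eq_analyticRank_of_analyticRank_le_one)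
    (hGS : ∀ (W : WeierstrassCurve ℚ) [W.IsElliptic] [W.IsGloballyMinimal] (p : ℕ) [Fact p.Prime],
      greenberg_stevens (W := W) (p := p))
    (hcert : ∀ (W : WeierstrassCurve ℚ) [W.IsElliptic] [W.IsGloballyMinimal] (p : ℕ) [Fact p.Prime],
      ClassX11a W p → p = 3 → ¬ X11a.ShaAnUnit W p → X11a.MuAnZeroAt W p ∧ MemberRatEqAt W p) :
    ∀ (W : WeierstrassCurve ℚ) [W.IsElliptic] [W.IsGloballyMinimal] (p : ℕ) [Fact p.Prime],
      ClassX11a W p → p = 3 → ¬ X11a.ShaAnUnit W p → MissingLowerBoundAt W p :=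
  lowerThreeDeep_of_forall_muAn_member_ratEq_of_facts hNf h311 hT1a hT1b h61 h326 hKato h20 h12 hns hsp h15 h18
    hfine hJs hJn hGZK hGS fun W _ _ p _ hX hp3 hu => hcert W p hX hp3 hu

/-- **`stub_lowerThreeDeep` from «`μ^an = 0` at multiplicative `3`» AS A STATEMENT (`hμ3`) + `MemberRatEqAt W 3` on
the deep X11a pairs at `3` (`hmem`) + named facts** — once `hμ3` is a tree theorem (announced by the x11a line p2
modulo Mazur's Manin constant), the `p = 3` content of the crux is `hmem` ALONE: «X. Wan's Thm. 4 at `p = 3`» for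
one member per pair. CONDITIONAL; closes nothing by itself. [cite: GreenbergLNM1716, Conj. 1.11 (shape)]
[cite: Wan2015, Thm. 4 (p. 4)] [cite: EmertonPollackWeston2006, Thm. 5.1.3] [cite: Miller2011LMS, Def. 1.1] -/
theorem lowerThreeDeep_of_muAnThree_of_forall_memberRatEqAt_of_facts
    (hNf : exists_isNewformOf)
    (h311 : thm311_cotorsion_weightK_member_ofLevel_odd) (hT1a : thm1_muAlg_of_weightK_member_ofLevel_odd)
    (hT1b : thm513_transfer_from_weightK_member_of_bdd_ofLevel_odd)
    (h61 : DeligneSerre1974.thm61_exists_adicGaloisRep) (h326 : Hida2000_thm326_ordinary)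
    (hKato : kato_charIdeal_dvd_multiplicative_of_surjective)
    (h20 : lemma20_surjective_threeAdic_of_semistable)
    (h12 : Kato2004.thm12_4)
    (hns : Kato2004.exists_multDivisibilityInputs_nonsplit)
    (hsp : Kato2004.exists_multDivisibilityInputs_split)
    (h15 : thm15_isTorsion_multiplicative_rat)
    (h18 : Wuthrich2014.corollary18_padicLFunction_mem_iwasawaAlgebra_multiplicative)
    (hfine : Kato2004.exists_multDivisibilityInputs_fine)
    (hJs : thm61_splitMultiplicative) (hJn : thm61_nonsplitMultiplicative)
    (hGZK : rank_eq_analyticRank_of_analyticRank_le_one)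
    (hGS : ∀ (W : WeierstrassCurve ℚ) [W.IsElliptic] [W.IsGloballyMinimal] (p : ℕ) [Fact p.Prime],
      greenberg_stevens (W := W) (p := p))
    (hμ3 : ∀ (W : WeierstrassCurve ℚ) [W.IsElliptic] [W.IsGloballyMinimal],
      W.HasMultiplicativeReductionAtPrime 3 → W.HasIrreducibleModPGaloisRep 3 → X11a.MuAnZeroAt W 3)
    (hmem : ∀ (W : WeierstrassCurve ℚ) [W.IsElliptic] [W.IsGloballyMinimal] (p : ℕ) [Fact p.Prime],
      ClassX11a W p → p = 3 → ¬ X11a.ShaAnUnit W p → MemberRatEqAt W p) :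
    ∀ (W : WeierstrassCurve ℚ) [W.IsElliptic] [W.IsGloballyMinimal] (p : ℕ) [Fact p.Prime],
      ClassX11a W p → p = 3 → ¬ X11a.ShaAnUnit W p → MissingLowerBoundAt W p :=
  lowerThreeDeep_of_muAnThree_of_forall_member_ratEq_of_facts hNf h311 hT1a hT1b h61 h326 hKato h20 h12 hns hsp
    h15 h18 hfine hJs hJn hGZK hGS hμ3 fun W _ _ p _ hX hp3 hu => hmem W p hX hp3 hu

/-- **The WHOLE body of crux `X11aLowerHalf`** (`∀` X11a pairs, `Typed.MissingLowerBoundAt W p` — the unfolding of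
`Theses.ErratumRoadFive.X11aLowerHalf` = `Theses.PrintX11a.X11aLowerHalf`; no route file imported) **from the named
facts + THREE per-locus statements**: (a) `stub_muAnDeepFive`'s statement VERBATIM (the certificate on the deep X11a
pairs at `p ≥ 5`), (b) «`μ^an = 0` at multiplicative `3`» (`hμ3`), (c) «`MemberRatEqAt W 3` on the deep X11a pairs at
`3`» (`hmem3`). The `p ≥ 5` part is g0's p610393 (`NonSurjChain.x11aLowerHalf_body_of_three_of_forall_muAnZeroAt_of_facts`,
Wan's fact `hT2` discharging the member input there; the EPW `_ofLevel` facts it binds are derived from the odd ones);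
the `p = 3` part is the previous theorem. A turnkey for the lead's next reshape (his call). CONDITIONAL; closes
nothing by itself. [cite: EmertonPollackWeston2006, Thm. 1, Thm. 3.1.1, Thm. 5.1.3] [cite: Wan2015, Thm. 4 (pp. 4–5)]
[cite: GreenbergLNM1716, Conj. 1.11 (shape)] [cite: Miller2011LMS, §1 and Def. 1.1] -/
theorem x11aLowerHalf_body_of_muAnFive_muAnThree_memberRatEqAtThree_of_facts
    (hNf : exists_isNewformOf)
    (h311 : thm311_cotorsion_weightK_member_ofLevel_odd) (hT1a : thm1_muAlg_of_weightK_member_ofLevel_odd)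
    (hT2 : Wan2015.thm4_rational_weightK_member_of_bdd_ofLevel_irred)
    (hT1b : thm513_transfer_from_weightK_member_of_bdd_ofLevel_odd)
    (h61 : DeligneSerre1974.thm61_exists_adicGaloisRep) (h326 : Hida2000_thm326_ordinary)
    (hKato : kato_charIdeal_dvd_multiplicative_of_surjective)
    (h20 : lemma20_surjective_threeAdic_of_semistable)
    (h12 : Kato2004.thm12_4)
    (hns : Kato2004.exists_multDivisibilityInputs_nonsplit)
    (hsp : Kato2004.exists_multDivisibilityInputs_split)
    (h15 : thm15_isTorsion_multiplicative_rat)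
    (h18 : Wuthrich2014.corollary18_padicLFunction_mem_iwasawaAlgebra_multiplicative)
    (hfine : Kato2004.exists_multDivisibilityInputs_fine)
    (hJs : thm61_splitMultiplicative) (hJn : thm61_nonsplitMultiplicative)
    (hGZK : rank_eq_analyticRank_of_analyticRank_le_one)
    (hGS : ∀ (W : WeierstrassCurve ℚ) [W.IsElliptic] [W.IsGloballyMinimal] (p : ℕ) [Fact p.Prime],
      greenberg_stevens (W := W) (p := p))
    (hcert5 : ∀ (W : WeierstrassCurve ℚ) [W.IsElliptic] [W.IsGloballyMinimal] (p : ℕ) [Fact p.Prime],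
      ClassX11a W p → 5 ≤ p → ¬ X11a.ShaAnUnit W p → X11a.MuAnZeroAt W p)
    (hμ3 : ∀ (W : WeierstrassCurve ℚ) [W.IsElliptic] [W.IsGloballyMinimal],
      W.HasMultiplicativeReductionAtPrime 3 → W.HasIrreducibleModPGaloisRep 3 → X11a.MuAnZeroAt W 3)
    (hmem3 : ∀ (W : WeierstrassCurve ℚ) [W.IsElliptic] [W.IsGloballyMinimal] (p : ℕ) [Fact p.Prime],
      ClassX11a W p → p = 3 → ¬ X11a.ShaAnUnit W p → MemberRatEqAt W p) :
    ∀ (W : WeierstrassCurve ℚ) [W.IsElliptic] [W.IsGloballyMinimal] (p : ℕ) [Fact p.Prime],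
      ClassX11a W p → MissingLowerBoundAt W p :=
  NonSurjChain.x11aLowerHalf_body_of_three_of_forall_muAnZeroAt_of_facts hNf (thm311_ofLevel_of_odd h311)
    (thm1_ofLevel_of_odd hT1a) hT2 (thm513_ofLevel_of_odd hT1b) h61 h326 hKato h12 hns hsp h15 h18 hfine hJs hJn
    hGZK hGS
    (lowerThreeDeep_of_muAnThree_of_forall_memberRatEqAt_of_facts hNf h311 hT1a hT1b h61 h326 hKato h20 h12 hns
      hsp h15 h18 hfine hJs hJn hGZK hGS hμ3 hmem3)
    hcert5

/-- **`stub_lowerThreeDeep` ⟸ 21 named PUBLISHED facts + ONE statement.** The certificate component at `p = 3` is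
now a tree THEOREM modulo Mazur's Manin-constant fact: `MultThreeMuAn.muAnZeroAt_three_of_mult_of_irr` (x11a line
p2, 2026-08-28: `μ^an(E,3) = 0` for EVERY `E` with `3 ∥ N` and `E[3]` irreducible — Greenberg's analytic statement at
multiplicative `3`, class-free, from an Atkin–Lehner-extended orbit trick). Feeding it to
`lowerThreeDeep_of_muAnThree_of_forall_memberRatEqAt_of_facts`: the registered `p = 3` stub of crux `X11aLowerHalf`
follows from the facts (EPW odd ×3, DS 6.1, Hida 3.26, modularity, A32, Lemma 20, Kato 12.4 ∕ §17.13 ×3, Greenberg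
1.5, Wuthrich Cor. 18, Stein–Wuthrich 6.1 ×2, GZK, Mazur 1978 Cor. 4.1 `hMz`) + Greenberg–Stevens + the SINGLE
`∀`-statement «`MemberRatEqAt W 3` at every deep X11a pair at `3`» (X. Wan's Thm. 4 at `p = 3` for one good-ordinary
member of `H(E[3])` per pair — NOT in print). CONDITIONAL on that statement and the displayed facts; closes nothing
by itself. [cite: Mazur1978, Cor. 4.1] [cite: Wan2015, Thm. 4 (p. 4: "Suppose that p ⩾ 5")]
[cite: EmertonPollackWeston2006, Thm. 5.1.3, Notation p. 5] [cite: GreenbergLNM1716, §1 Conj. 1.11 (p. 58)] [cite: Miller2011LMS, Def. 1.1] -/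
theorem lowerThreeDeep_of_mazur_of_forall_memberRatEqAt_of_facts
    (hNf : exists_isNewformOf)
    (h311 : thm311_cotorsion_weightK_member_ofLevel_odd) (hT1a : thm1_muAlg_of_weightK_member_ofLevel_odd)
    (hT1b : thm513_transfer_from_weightK_member_of_bdd_ofLevel_odd)
    (h61 : DeligneSerre1974.thm61_exists_adicGaloisRep) (h326 : Hida2000_thm326_ordinary)
    (hKato : kato_charIdeal_dvd_multiplicative_of_surjective)
    (h20 : lemma20_surjective_threeAdic_of_semistable)
    (h12 : Kato2004.thm12_4)
    (hns : Kato2004.exists_multDivisibilityInputs_nonsplit)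
    (hsp : Kato2004.exists_multDivisibilityInputs_split)
    (h15 : thm15_isTorsion_multiplicative_rat)
    (h18 : Wuthrich2014.corollary18_padicLFunction_mem_iwasawaAlgebra_multiplicative)
    (hfine : Kato2004.exists_multDivisibilityInputs_fine)
    (hJs : thm61_splitMultiplicative) (hJn : thm61_nonsplitMultiplicative)
    (hGZK : rank_eq_analyticRank_of_analyticRank_le_one)
    (hGS : ∀ (W : WeierstrassCurve ℚ) [W.IsElliptic] [W.IsGloballyMinimal] (p : ℕ) [Fact p.Prime],
      greenberg_stevens (W := W) (p := p))
    (hMz : mazur_not_dvd_maninConstant_of_odd)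
    (hmem : ∀ (W : WeierstrassCurve ℚ) [W.IsElliptic] [W.IsGloballyMinimal] (p : ℕ) [Fact p.Prime],
      ClassX11a W p → p = 3 → ¬ X11a.ShaAnUnit W p → MemberRatEqAt W p) :
    ∀ (W : WeierstrassCurve ℚ) [W.IsElliptic] [W.IsGloballyMinimal] (p : ℕ) [Fact p.Prime],
      ClassX11a W p → p = 3 → ¬ X11a.ShaAnUnit W p → MissingLowerBoundAt W p :=
  lowerThreeDeep_of_muAnThree_of_forall_memberRatEqAt_of_facts hNf h311 hT1a hT1b h61 h326 hKato h20 h12 hns hsp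
    h15 h18 hfine hJs hJn hGZK hGS (fun W _ _ => MultThreeMuAn.muAnZeroAt_three_of_mult_of_irr hMz W) hmem

/-- **The WHOLE body of crux `X11aLowerHalf` from the named facts (incl. Mazur's Manin constant `hMz`) + TWO
statements**: (a) `stub_muAnDeepFive`'s statement VERBATIM (Greenberg's analytic statement on the deep X11a pairs at
`p ≥ 5` — per pair a certificate), (c) «`MemberRatEqAt W 3` on the deep X11a pairs at `3`» (Wan's Thm. 4 at `p = 3`
for one member per pair). The `p = 3` certificate is x11a line p2's theorem. A turnkey for the lead's next reshape
of line birth (his call): stubs {`stub_muAnDeepFive`, «member-with-equality at 3», fact bundles}. CONDITIONAL;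
closes nothing by itself. [cite: EmertonPollackWeston2006, Thm. 1, Thm. 3.1.1, Thm. 5.1.3] [cite: Wan2015, Thm. 4 (pp. 4–5)]
[cite: Mazur1978, Cor. 4.1] [cite: GreenbergLNM1716, Conj. 1.11 (shape)] [cite: Miller2011LMS, §1 and Def. 1.1] -/
theorem x11aLowerHalf_body_of_muAnFive_mazur_memberRatEqAtThree_of_facts
    (hNf : exists_isNewformOf)
    (h311 : thm311_cotorsion_weightK_member_ofLevel_odd) (hT1a : thm1_muAlg_of_weightK_member_ofLevel_odd)
    (hT2 : Wan2015.thm4_rational_weightK_member_of_bdd_ofLevel_irred)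
    (hT1b : thm513_transfer_from_weightK_member_of_bdd_ofLevel_odd)
    (h61 : DeligneSerre1974.thm61_exists_adicGaloisRep) (h326 : Hida2000_thm326_ordinary)
    (hKato : kato_charIdeal_dvd_multiplicative_of_surjective)
    (h20 : lemma20_surjective_threeAdic_of_semistable)
    (h12 : Kato2004.thm12_4)
    (hns : Kato2004.exists_multDivisibilityInputs_nonsplit)
    (hsp : Kato2004.exists_multDivisibilityInputs_split)
    (h15 : thm15_isTorsion_multiplicative_rat)
    (h18 : Wuthrich2014.corollary18_padicLFunction_mem_iwasawaAlgebra_multiplicative)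
    (hfine : Kato2004.exists_multDivisibilityInputs_fine)
    (hJs : thm61_splitMultiplicative) (hJn : thm61_nonsplitMultiplicative)
    (hGZK : rank_eq_analyticRank_of_analyticRank_le_one)
    (hGS : ∀ (W : WeierstrassCurve ℚ) [W.IsElliptic] [W.IsGloballyMinimal] (p : ℕ) [Fact p.Prime],
      greenberg_stevens (W := W) (p := p))
    (hMz : mazur_not_dvd_maninConstant_of_odd)
    (hcert5 : ∀ (W : WeierstrassCurve ℚ) [W.IsElliptic] [W.IsGloballyMinimal] (p : ℕ) [Fact p.Prime],
      ClassX11a W p → 5 ≤ p → ¬ X11a.ShaAnUnit W p → X11a.MuAnZeroAt W p)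
    (hmem3 : ∀ (W : WeierstrassCurve ℚ) [W.IsElliptic] [W.IsGloballyMinimal] (p : ℕ) [Fact p.Prime],
      ClassX11a W p → p = 3 → ¬ X11a.ShaAnUnit W p → MemberRatEqAt W p) :
    ∀ (W : WeierstrassCurve ℚ) [W.IsElliptic] [W.IsGloballyMinimal] (p : ℕ) [Fact p.Prime],
      ClassX11a W p → MissingLowerBoundAt W p :=
  x11aLowerHalf_body_of_muAnFive_muAnThree_memberRatEqAtThree_of_facts hNf h311 hT1a hT2 hT1b h61 h326 hKato h20
    h12 hns hsp h15 h18 hfine hJs hJn hGZK hGS hcert5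
    (fun W _ _ => MultThreeMuAn.muAnZeroAt_three_of_mult_of_irr hMz W) hmem3

end ClassLevel

end Summit.BirchSwinnertonDyer.BirchSwinnertonDyer.Theorems.OddChain

end
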